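import Literature.NumberTheory.Automorphic.ResGLnCoeffIntegralForm
import Literature.NumberTheory.Automorphic.ResGLnAdelicCoefficients
import Literature.NumberTheory.Automorphic.PadicPlaceCoefficientRing
import Literature.NumberTheory.Automorphic.BorelStabilizerLattice
import Literature.NumberTheory.Automorphic.PadicIntermediateFieldUnitBall
import HarnessLib

/-!
# The lattice `M_λ(𝒪_E) ⊆ E_λ(ℚ̄_p)` over the unit ball of a finite `E ⊇ coeffField`:
# stability under `GL_n(𝒪̂_K)` and congruences under `K_f((p)^r)`

Topic `NumberTheory/Automorphic`; namespace `Literature.NumberTheory.Automorphic.ResGLnCohomology`.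
Definitions with bodies and theorems; no named fact, no instance, no `sorry`.

For a finite extension `E/ℚ_p` inside `ℚ̄_p` containing the coefficient field `coeffField K p` of
`PadicPlaceCoefficientRing` (so that all the continuous extensions `φ_τ : K_{v(τ)} → ℚ̄_p` map
`𝒪_{v(τ)}` into `𝒪_E = unitBall p E`):

* `glOfEntries` — an invertible matrix over a field whose entries and inverse entries are mapped
  into a subring gives an invertible matrix over that subring; whence the `GL_n(𝒪_E)`-points
  `padicLocalUnit τ u` attached to `u ∈ GL_n(𝒪̂_K)` (`map_padicLocalUnit`);
* **`padicCoeffRep_mem_coeffIntForm_unitBall`** — `ρ_p(u)` preserves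
  `M = coeffIntForm ℚ̄_p 𝒪_E n K λ` for `u ∈ GL_n(𝒪̂_K)`;
* **`padicCoeffRep_sub_mem_smul_coeffIntForm_unitBall`** — for `u ∈ GL_n(𝒪̂_K) ∩ K_f((p)^r)`,
  `ρ_p(u) x - x ∈ p^r M` (`x ∈ M`): the level `K_f((p)^r)` acts trivially on `M / p^r`.

These are the properties "`M_ξ` is `K_p`-stable" and "`K_p` sufficiently small so that `M_ξ/p^m`
is a trivial `K_p`-module" of [Scholze2015, §V.4, proof of Thm. V.4.1], for the Noetherian
coefficient rings `𝒪_E` (from `ResGLnCoeffIntegralForm.adelicCoeffRep_mem_coeffIntForm`,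
`adelicCoeffRep_sub_mem_smul_coeffIntForm`).

## References

* P. Scholze, *On torsion in the cohomology of locally symmetric varieties*, Ann. of Math. 182
  (2015), §V.4 (arXiv:1306.2070, pp. 66–67). [Scholze2015]
* J. Neukirch, *Algebraic Number Theory* (1999), Ch. II §8. [NeukirchANT1999]
-/

noncomputable section

open scoped NumberField
open IsDedekindDomain

namespace Literature.NumberTheory.Automorphic

/-! ### Invertible matrices with entries in a subring -/

section GLOfEntries

variable {m : Type*} [Fintype m] [DecidableEq m] {F R : Type*} [CommRing F] [CommRing R]
  (φ : F →+* R) (S : Subring R)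

/-- **An invertible matrix whose entries and inverse entries map into a subring `S` defines an
element of `GL_m(S)`.** [folklore] -/
def glOfEntries (g : GL m F) (h : ∀ i j, φ ((g : Matrix m m F) i j) ∈ S)
    (h' : ∀ i j, φ (((g⁻¹ : GL m F) : Matrix m m F) i j) ∈ S) : GL m S where
  val := Matrix.of fun i j => ⟨φ ((g : Matrix m m F) i j), h i j⟩
  inv := Matrix.of fun i j => ⟨φ (((g⁻¹ : GL m F) : Matrix m m F) i j), h' i j⟩
  val_inv := by
    apply Matrix.map_injective S.subtype_injective
    dsimp only
    have h1 : (Matrix.of fun i j => (⟨φ ((g : Matrix m m F) i j), h i j⟩ : S)).map S.subtype =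
        (g : Matrix m m F).map φ := rfl
    have h2 : (Matrix.of fun i j => (⟨φ (((g⁻¹ : GL m F) : Matrix m m F) i j), h' i j⟩ : S)).map
        S.subtype = ((g⁻¹ : GL m F) : Matrix m m F).map φ := rfl
    rw [Matrix.map_mul, Matrix.map_one S.subtype (map_zero _) (map_one _), h1, h2, ← Matrix.map_mul,
      ← Matrix.GeneralLinearGroup.coe_mul, mul_inv_cancel, Units.val_one,
      Matrix.map_one φ (map_zero φ) (map_one φ)]
  inv_val := by
    apply Matrix.map_injective S.subtype_injective
    dsimp only
    have h1 : (Matrix.of fun i j => (⟨φ ((g : Matrix m m F) i j), h i j⟩ : S)).map S.subtype =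
        (g : Matrix m m F).map φ := rfl
    have h2 : (Matrix.of fun i j => (⟨φ (((g⁻¹ : GL m F) : Matrix m m F) i j), h' i j⟩ : S)).map
        S.subtype = ((g⁻¹ : GL m F) : Matrix m m F).map φ := rfl
    rw [Matrix.map_mul, Matrix.map_one S.subtype (map_zero _) (map_one _), h1, h2, ← Matrix.map_mul,
      ← Matrix.GeneralLinearGroup.coe_mul, inv_mul_cancel, Units.val_one,
      Matrix.map_one φ (map_zero φ) (map_one φ)]

/-- Entries of `glOfEntries`. [folklore] -/
@[simp]
theorem coe_glOfEntries_apply (g : GL m F) (h : ∀ i j, φ ((g : Matrix m m F) i j) ∈ S)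
    (h' : ∀ i j, φ (((g⁻¹ : GL m F) : Matrix m m F) i j) ∈ S) (i j : m) :
    (((glOfEntries φ S g h h' : GL m S) : Matrix m m S) i j : R) = φ ((g : Matrix m m F) i j) :=
  rfl

/-- `GL_m(φ) g = GL_m(S ⊆ R) (glOfEntries φ S g)`. [folklore] -/
theorem map_glOfEntries (g : GL m F) (h : ∀ i j, φ ((g : Matrix m m F) i j) ∈ S)
    (h' : ∀ i j, φ (((g⁻¹ : GL m F) : Matrix m m F) i j) ∈ S) :
    Matrix.GeneralLinearGroup.map φ g = Matrix.GeneralLinearGroup.map S.subtype (glOfEntries φ S g h h') :=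
  Units.ext (Matrix.ext fun _ _ => rfl)

end GLOfEntries

namespace ResGLnCohomology

open BigHeckeGLn ParallelWeight PadicIntermediateField

variable {n : ℕ} {K : Type} [Field K] [NumberField K] (p : ℕ) [Fact p.Prime]
  (E : IntermediateField ℚ_[p] (PadicAlgCl p)) (hE : coeffField K p ≤ E)
  (lam : (K →+* PadicAlgCl p) → Fin n → ℤ)

/-! ### `φ_τ(𝒪_{v(τ)}) ⊆ 𝒪_E` -/

include hE in
/-- `φ_τ` maps `𝒪_{v(τ)}` into `𝒪_E` for `E ⊇ coeffField`. [cite: NeukirchANT1999, Ch. II §8] -/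
theorem padicPlaceHom_mem_unitBall (τ : K →+* PadicAlgCl p) {y : (padicPlace K p τ).adicCompletion K}
    (hy : Valued.v y ≤ 1) : padicPlaceHom K p τ y ∈ unitBall p E :=
  unitBall_mono p E _ hE (by
    rw [← coeffRing_eq_unitBall]
    exact padicPlaceHom_mem_coeffRing K p τ y hy)

include hE in
/-- **The `GL_n(𝒪_E)`-point `φ_τ(u_{v(τ)})` of `u ∈ GL_n(𝒪̂_K)`.** [folklore] -/
def padicLocalUnit (τ : K →+* PadicAlgCl p) (u : FiniteAdelicGL n K)
    (hu : u ∈ glFiniteIntegralLevel n K) : GL (Fin n) (unitBall p E) :=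
  glOfEntries (padicPlaceHom K p τ) (unitBall p E) (localComponent n K (padicPlace K p τ) u)
    (fun i j => padicPlaceHom_mem_unitBall p E hE τ
      ((mem_valuedCongruenceSubgroup_iff.1
        (mem_glFiniteIntegralLevel_iff_localComponent.1 hu _)).1 i j))
    (fun i j => padicPlaceHom_mem_unitBall p E hE τ
      ((mem_valuedCongruenceSubgroup_iff.1
        (mem_glFiniteIntegralLevel_iff_localComponent.1 hu _)).2.1 i j))

/-- `GL_n(φ_τ)(u_{v(τ)}) = padicLocalUnit τ u` in `GL_n(ℚ̄_p)`. [folklore] -/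
theorem map_padicLocalUnit (τ : K →+* PadicAlgCl p) (u : FiniteAdelicGL n K)
    (hu : u ∈ glFiniteIntegralLevel n K) :
    Matrix.GeneralLinearGroup.map (padicPlaceHom K p τ) (localComponent n K (padicPlace K p τ) u) =
      Matrix.GeneralLinearGroup.map (unitBall p E).subtype (padicLocalUnit p E hE τ u hu) :=
  map_glOfEntries _ _ _ _ _

/-! ### Stability -/

include hE in
/-- **`ρ_p(u)` preserves `M_λ(𝒪_E)` for `u ∈ GL_n(𝒪̂_K)`.**
[cite: Scholze2015, §V.4 (proof of Thm. V.4.1: M_ξ is K_p-stable)] -/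
theorem padicCoeffRep_mem_coeffIntForm_unitBall {u : FiniteAdelicGL n K}
    (hu : u ∈ glFiniteIntegralLevel n K) {x : CoeffModule (PadicAlgCl p) n K lam}
    (hx : x ∈ coeffIntForm (PadicAlgCl p) (unitBall p E) n K lam) :
    padicCoeffRep n K p lam u x ∈ coeffIntForm (PadicAlgCl p) (unitBall p E) n K lam :=
  adelicCoeffRep_mem_coeffIntForm (PadicAlgCl p) (unitBall p E) n K lam (padicPlace K p)
    (padicPlaceHom K p) (fun τ => padicLocalUnit p E hE τ u hu)
    (fun τ => map_padicLocalUnit p E hE τ u hu) hx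

/-! ### Congruences modulo `p^r` -/

omit [Fact p.Prime] in
/-- `|p|_v = v(p)` in `K_v`. [folklore] -/
theorem valued_natCast_eq_intValuation (v : HeightOneSpectrum (𝓞 K)) :
    Valued.v ((p : v.adicCompletion K)) = v.intValuation ((p : ℕ) : 𝓞 K) := by
  have h1 : (p : v.adicCompletion K) = ((p : K) : v.adicCompletion K) := by
    rw [← map_natCast (algebraMap K (v.adicCompletion K)) p]; rfl
  have h2 : (p : K) = algebraMap (𝓞 K) K ((p : ℕ) : 𝓞 K) := (map_natCast _ p).symm
  rw [h1, HeightOneSpectrum.valuedAdicCompletion_eq_valuation', h2,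
    HeightOneSpectrum.valuation_of_algebraMap]

omit [Fact p.Prime] in
/-- `|(p)^r|_v = |p|_v^r` for the ideal radius. [folklore] -/
theorem idealRadius_span_natCast_pow (v : HeightOneSpectrum (𝓞 K)) (hp : p ≠ 0) (r : ℕ) :
    idealRadius K v (Ideal.span {((p : ℕ) : 𝓞 K)} ^ r) =
      Valued.v ((p : v.adicCompletion K)) ^ r := by
  have hp' : ((p : ℕ) : 𝓞 K) ^ r ≠ 0 := pow_ne_zero r (by exact_mod_cast hp)
  have h0 : (Ideal.span {((p : ℕ) : 𝓞 K) ^ r} : Ideal (𝓞 K)) ≠ 0 := by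
    rwa [Ne, Ideal.zero_eq_bot, Ideal.span_singleton_eq_bot]
  rw [Ideal.span_singleton_pow, idealRadius, FractionalIdeal.count_coe K v h0,
    ← v.intValuation_if_neg hp', map_pow, valued_natCast_eq_intValuation]

/-- An element of `K_v` of valuation `≤ |p^r|_v` is `p^r y` with `|y|_v ≤ 1`. [folklore] -/
theorem exists_eq_natCast_pow_mul (v : HeightOneSpectrum (𝓞 K)) (r : ℕ) {x : v.adicCompletion K}
    (hx : Valued.v x ≤ Valued.v ((p : v.adicCompletion K)) ^ r) :
    ∃ y : v.adicCompletion K, Valued.v y ≤ 1 ∧ x = (p : v.adicCompletion K) ^ r * y := by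
  have hp : (p : v.adicCompletion K) ≠ 0 := by
    rw [Ne, ← map_natCast (algebraMap K (v.adicCompletion K)), map_eq_zero_iff _
      (algebraMap K (v.adicCompletion K)).injective]
    exact_mod_cast (Fact.out : p.Prime).ne_zero
  have hpr : (p : v.adicCompletion K) ^ r ≠ 0 := pow_ne_zero r hp
  refine ⟨((p : v.adicCompletion K) ^ r)⁻¹ * x, ?_, by rw [← mul_assoc, mul_inv_cancel₀ hpr, one_mul]⟩
  rw [map_mul, map_inv₀]
  rw [← map_pow] at hx
  have hv : Valued.v ((p : v.adicCompletion K) ^ r) ≠ 0 := (Valuation.ne_zero_iff _).2 hpr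
  calc (Valued.v ((p : v.adicCompletion K) ^ r))⁻¹ * Valued.v x
      ≤ (Valued.v ((p : v.adicCompletion K) ^ r))⁻¹ * Valued.v ((p : v.adicCompletion K) ^ r) := by
        gcongr
    _ = 1 := inv_mul_cancel₀ hv

include hE in
/-- The entries of `padicLocalUnit τ u` are `≡ δ_{ij} (mod p^r)` for `u ∈ K_f((p)^r)`. [folklore] -/
theorem padicLocalUnit_sub_one_mem (τ : K →+* PadicAlgCl p) {u : FiniteAdelicGL n K}
    (hu : u ∈ glFiniteIntegralLevel n K) (r : ℕ)
    (hu' : u ∈ (principalCongruenceLevel n K (Ideal.span {((p : ℕ) : 𝓞 K)} ^ r)).comap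
      (GLn.ofFinite n K)) (i j : Fin n) :
    ((padicLocalUnit p E hE τ u hu : GL (Fin n) (unitBall p E)) : Matrix (Fin n) (Fin n) (unitBall p E)) i j -
        (1 : Matrix (Fin n) (Fin n) (unitBall p E)) i j ∈
      (Ideal.span {((p : ℕ) : unitBall p E) ^ r} : Ideal (unitBall p E)) := by
  have hmem := (mem_valuedCongruenceSubgroup_iff.1
    (mem_comap_principalCongruenceLevel_iff_localComponent.1 hu' (padicPlace K p τ))).2.2 i j
  rw [idealRadius_span_natCast_pow p (padicPlace K p τ) (Fact.out : p.Prime).ne_zero r] at hmem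
  obtain ⟨y, hy, hxy⟩ := exists_eq_natCast_pow_mul p (padicPlace K p τ) r hmem
  rw [Ideal.mem_span_singleton']
  refine ⟨⟨padicPlaceHom K p τ y, padicPlaceHom_mem_unitBall p E hE τ hy⟩, Subtype.ext ?_⟩
  have h1 : (((padicLocalUnit p E hE τ u hu : GL (Fin n) (unitBall p E)) :
      Matrix (Fin n) (Fin n) (unitBall p E)) i j : PadicAlgCl p) -
      ((1 : Matrix (Fin n) (Fin n) (unitBall p E)) i j : PadicAlgCl p) =
      padicPlaceHom K p τ (((localComponent n K (padicPlace K p τ) u :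
        Matrix (Fin n) (Fin n) ((padicPlace K p τ).adicCompletion K)) - 1) i j) := by
    rw [Matrix.sub_apply, map_sub, padicLocalUnit, coe_glOfEntries_apply, Matrix.one_apply,
      Matrix.one_apply]
    split_ifs <;> simp
  rw [Subring.coe_mul, SubmonoidClass.coe_pow, Subring.coe_natCast, AddSubgroupClass.coe_sub, h1, hxy,
    map_mul, map_pow, map_natCast, mul_comm]

include hE in
/-- **`K_f((p)^r) ∩ GL_n(𝒪̂_K)` acts trivially on `M_λ(𝒪_E) / p^r`**: `ρ_p(u) x - x ∈ p^r M`.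
[cite: Scholze2015, §V.4 (proof of Thm. V.4.1)] -/
theorem padicCoeffRep_sub_mem_smul_coeffIntForm_unitBall (r : ℕ) {u : FiniteAdelicGL n K}
    (hu : u ∈ glFiniteIntegralLevel n K)
    (hu' : u ∈ (principalCongruenceLevel n K (Ideal.span {((p : ℕ) : 𝓞 K)} ^ r)).comap
      (GLn.ofFinite n K))
    {x : CoeffModule (PadicAlgCl p) n K lam}
    (hx : x ∈ coeffIntForm (PadicAlgCl p) (unitBall p E) n K lam) :
    padicCoeffRep n K p lam u x - x ∈
      (Ideal.span {((p : ℕ) : unitBall p E) ^ r} : Ideal (unitBall p E)) •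
        coeffIntForm (PadicAlgCl p) (unitBall p E) n K lam :=
  adelicCoeffRep_sub_mem_smul_coeffIntForm (PadicAlgCl p) (unitBall p E) n K lam (padicPlace K p)
    (padicPlaceHom K p) _ (fun τ => padicLocalUnit p E hE τ u hu)
    (fun τ => map_padicLocalUnit p E hE τ u hu)
    (fun τ i j => padicLocalUnit_sub_one_mem p E hE τ hu r hu' i j) hx

end ResGLnCohomology

end Literature.NumberTheory.Automorphic
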